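import Literature.NumberTheory.Automorphic.UnitaryRankTwoTorusLocalClass        -- ★ B-p12 (g29) I-1 LEMMA U `localClass_normalForm`
import Literature.NumberTheory.Automorphic.ReductiveGroupData                   -- ★ `mem_glInt_iff`
import HarnessLib

/-!
# The VALUE LAW of a class function at the fixed vertices of an elliptic torus element of `U(1,1)`: at depth `≥ m` the value is that at `c·1`, at depth `i < m` it is the
# value at the normal form `c·(1 + ϖ^i·[[0, δ],[0, 0]])` (Rogawski 1990 §4.9; Labesse–Langlands 1979 §2 — road «R1LL-tree», (α) LAYER 2-B, generic half)

Topic `NumberTheory/Automorphic`; namespace `Literature.NumberTheory.Automorphic`.  THEOREMS ONLY (no definition, no instance, no notation, no named fact, no `sorry`).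
Cell `pub/hodgecm-mathlib`, F0∕P3a road «R1LL-tree» (architect A-p16 (g27) RULINGS A-8 (c), A-13 (a), A-14 (a)), hand A-p13 (g31).  GENERIC over a valued field `F` with an
involution `σ` and the split hermitian form `J = [[0,1],[1,0]]` — the group is written `unitaryGroupOfForm σ J` with `J` a VARIABLE and `hJ : J = !![0, 1; 1, 0]`, so that
the CM instantiation `J := placeForm Φ₂ w.1` is literal (no subtype transport).  HC_CM is proved only modulo the printed citations until rung 0 closes; nothing printed is
asserted here — elementary matrix algebra over ★ LEMMA U.

* §1 `2 × 2` bookkeeping: the nilpotent `N_δ = [[0, δ],[0, 0]]`, `(1 + tN)(1 − tN) = 1`, swap conjugation, products of integral matrices.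
* §2 **`exists_unitary_normalForm_elements`** — for `σ c · c = 1`, `|c| = 1`, `σ ϖ = ϖ`, `δ = σ a₀ − a₀`: elements `xm, x i ∈ U(J) ∩ GL₂(𝒪)` with
  `↑xm = c • 1`, `↑(x i) = c • (1 + ϖ^i • N_δ)`, and their inverses `c⁻¹ • 1`, `c⁻¹ • (1 − ϖ^i • N_δ)`.
* §3 THE VALUE LAW for `φ : U(J) → E` invariant under `Ad K⁰` (`K⁰ = U(J) ∩ GL₂(𝒪)`) and under right translation by `Km` (DATA + the entrywise membership
  `∀ y, (∀ r s, ϖ^{−m}(↑y − 1) r s ∈ 𝒪) → y ∈ Km`), at `k ∈ U(J)` integral with `(k − a)(k − c) = 0` (`a, c` norm-one units, `|a − c| = |ϖ^n|`, `m ≤ n`):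
  **`apply_eq_apply_scalar_of_depth_le`** (`ϖ^{−m}(k − c·1)` integral ⇒ `φ k = φ xm`) and **`apply_eq_apply_normalForm_of_depth_eq`** (depth exactly `i < m` ⇒
  `φ k = φ (x i)`, by ★ `localClass_normalForm`: `κ⁻¹ k κ = x_i + ϖ^m R = x_i · y`, `y ∈ Km`, `κ ∈ K⁰`).
* §4 `sub_smul_mul_sub_smul_eq_zero_of_conj_diagonal` — `(k − u₀)(k − u₁) = 0` for `k = g⁻¹ γ g`, `γ P = P·diag(u)`; antitonicity of the depth predicate.

## References
* [Rogawski1990] J. D. Rogawski, *Automorphic Representations of Unitary Groups in Three Variables* (1990), §4.9 Lemma 4.9.3 p. 56.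
* [LabesseLanglands1979] J.-P. Labesse, R. P. Langlands, *L-indistinguishability for SL(2)*, Canad. J. Math. 31 (1979), §2.
* [Jacobowitz1962] R. Jacobowitz, *Hermitian forms over local fields*, Amer. J. Math. 84 (1962), §4.
-/

set_option autoImplicit false

noncomputable section

open scoped ValuativeRel Matrix MatrixGroups
open Matrix ValuativeRel

namespace Literature.NumberTheory.Automorphic

variable {F : Type*} [Field F] [ValuativeRel F]

/-! ## §1 `2 × 2` bookkeeping -/

section Algebra

omit [ValuativeRel F] in
/-- `N_δ² = 0`. [cite: Jacobowitz1962, §4] -/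
theorem nil_mul_nil (δ : F) : (!![0, δ; 0, 0] : Matrix (Fin 2) (Fin 2) F) * !![0, δ; 0, 0] = 0 := by
  ext i j; fin_cases i <;> fin_cases j <;> simp [Matrix.mul_apply, Fin.sum_univ_two]

omit [ValuativeRel F] in
/-- `(1 + t N_δ)(1 − t N_δ) = 1`. [cite: Jacobowitz1962, §4] -/
theorem one_add_smul_nil_mul_one_sub_smul_nil (t δ : F) :
    ((1 : Matrix (Fin 2) (Fin 2) F) + t • !![0, δ; 0, 0]) * (1 - t • !![0, δ; 0, 0]) = 1 := by
  rw [Matrix.mul_sub, Matrix.add_mul, Matrix.one_mul, Matrix.mul_one, Matrix.add_mul, Matrix.one_mul, Matrix.smul_mul, Matrix.mul_smul, nil_mul_nil,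
    smul_zero, smul_zero, add_zero, add_sub_cancel_right]

omit [ValuativeRel F] in
/-- `(1 − t N_δ)(1 + t N_δ) = 1`. [cite: Jacobowitz1962, §4] -/
theorem one_sub_smul_nil_mul_one_add_smul_nil (t δ : F) :
    ((1 : Matrix (Fin 2) (Fin 2) F) - t • !![0, δ; 0, 0]) * (1 + t • !![0, δ; 0, 0]) = 1 := by
  rw [Matrix.mul_add, Matrix.sub_mul, Matrix.one_mul, Matrix.mul_one, Matrix.sub_mul, Matrix.one_mul, Matrix.smul_mul, Matrix.mul_smul, nil_mul_nil,
    smul_zero, smul_zero, sub_zero, sub_add_cancel]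

omit [ValuativeRel F] in
/-- Swap conjugation permutes the entries: `J₀ M J₀ = [[M₁₁, M₁₀],[M₀₁, M₀₀]]`. [cite: Jacobowitz1962, §4] -/
theorem swap_mul_mul_swap_eq (M : Matrix (Fin 2) (Fin 2) F) :
    (!![(0 : F), 1; 1, 0] : Matrix (Fin 2) (Fin 2) F) * M * !![0, 1; 1, 0] = !![M 1 1, M 1 0; M 0 1, M 0 0] := by
  conv_lhs => rw [Matrix.eta_fin_two M]
  simp only [Matrix.mul_fin_two, zero_mul, one_mul, zero_add, add_zero, mul_zero, mul_one]

omit [ValuativeRel F] in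
/-- `J₀² = 1`. [cite: Jacobowitz1962, §4] -/
theorem swap_mul_swap_eq_one : (!![(0 : F), 1; 1, 0] : Matrix (Fin 2) (Fin 2) F) * !![0, 1; 1, 0] = 1 := by
  ext i j; fin_cases i <;> fin_cases j <;> simp [Matrix.mul_apply, Fin.sum_univ_two]

/-- Entries of a product of two integral `2 × 2` matrices are integral. [cite: Jacobowitz1962, §4] -/
theorem mul_apply_mem_integer {A B : Matrix (Fin 2) (Fin 2) F} (hA : ∀ r s, A r s ∈ 𝒪[F]) (hB : ∀ r s, B r s ∈ 𝒪[F]) (r s : Fin 2) :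
    (A * B) r s ∈ 𝒪[F] := by
  rw [Matrix.mul_apply, Fin.sum_univ_two]
  exact add_mem (mul_mem (hA r 0) (hB 0 s)) (mul_mem (hA r 1) (hB 1 s))

omit [ValuativeRel F] in
/-- `(c • (1 + tN))ᴴ J₀ (c • (1 + tN)) = J₀` when `σ c · c = 1`, `σ t = t`, `σ δ = −δ` (`N = N_δ`): the normal-form elements are `J₀`-unitary. [cite: Jacobowitz1962, §4] -/
theorem conjTranspose_normalForm_mul_swap_mul (σ : F →+* F) {c t δ : F} (hc : σ c * c = 1) (ht : σ t = t) (hδ : σ δ = -δ) :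
    ((c • ((1 : Matrix (Fin 2) (Fin 2) F) + t • !![0, δ; 0, 0])).map σ)ᵀ * !![0, 1; 1, 0] * (c • ((1 : Matrix (Fin 2) (Fin 2) F) + t • !![0, δ; 0, 0])) =
      !![0, 1; 1, 0] := by
  have h : c • ((1 : Matrix (Fin 2) (Fin 2) F) + t • !![0, δ; 0, 0]) = !![c, c * (t * δ); 0, c] := by
    ext i j; fin_cases i <;> fin_cases j <;> simp
  rw [h]
  ext i j
  fin_cases i <;> fin_cases j <;> simp [Matrix.mul_apply, Fin.sum_univ_two, ht, hδ, hc]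
  ring

end Algebra

/-! ## §2 The normal-form elements of `U(J)`, `J = [[0,1],[1,0]]` -/

section Elements

variable (σ : F →+* F)

/-- **THE NORMAL-FORM ELEMENTS**: for `σ c · c = 1` with `|c| = 1`, `σ ϖ = ϖ` with `ϖ ∈ 𝒪`, `δ ∈ 𝒪` with `σ δ = −δ`, and `J = [[0,1],[1,0]]`, there are `xm ∈ U(J)` and
`x : ℕ → U(J)`, all in `GL₂(𝒪)`, with `↑xm = c • 1`, `↑xm⁻¹ = c⁻¹ • 1`, `↑(x i) = c • (1 + ϖ^i • N_δ)`, `↑(x i)⁻¹ = c⁻¹ • (1 − ϖ^i • N_δ)`. [cite: Rogawski1990, §4.9 Lemma 4.9.3 p. 56] -/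
theorem exists_unitary_normalForm_elements (J : Matrix (Fin 2) (Fin 2) F) (hJ : J = !![0, 1; 1, 0]) {c ϖ δ : F} (hc : σ c * c = 1) (hc1 : valuation F c = 1)
    (hσϖ : σ ϖ = ϖ) (hϖO : ϖ ∈ 𝒪[F]) (hσδ : σ δ = -δ) (hδO : δ ∈ 𝒪[F]) :
    ∃ (xm : ↥(unitaryGroupOfForm σ J)) (x : ℕ → ↥(unitaryGroupOfForm σ J)),
      (xm : GL (Fin 2) F) ∈ glInt 2 F ∧ (∀ i, (x i : GL (Fin 2) F) ∈ glInt 2 F) ∧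
      ((xm : GL (Fin 2) F) : Matrix (Fin 2) (Fin 2) F) = c • (1 : Matrix (Fin 2) (Fin 2) F) ∧
      (((xm : GL (Fin 2) F)⁻¹ : GL (Fin 2) F) : Matrix (Fin 2) (Fin 2) F) = c⁻¹ • (1 : Matrix (Fin 2) (Fin 2) F) ∧
      (∀ i, ((x i : GL (Fin 2) F) : Matrix (Fin 2) (Fin 2) F) = c • ((1 : Matrix (Fin 2) (Fin 2) F) + ϖ ^ i • !![0, δ; 0, 0])) ∧
      (∀ i, (((x i : GL (Fin 2) F)⁻¹ : GL (Fin 2) F) : Matrix (Fin 2) (Fin 2) F) = c⁻¹ • ((1 : Matrix (Fin 2) (Fin 2) F) - ϖ ^ i • !![0, δ; 0, 0])) := by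
  have hc0 : c ≠ 0 := fun h => by rw [h, mul_zero] at hc; exact zero_ne_one hc
  have hcO : c ∈ 𝒪[F] := (Valuation.mem_integer_iff _ _).2 hc1.le
  have hcO' : c⁻¹ ∈ 𝒪[F] := (Valuation.mem_integer_iff _ _).2 (by rw [map_inv₀, hc1, inv_one])
  -- the `GL₂` elements
  let g : ℕ → GL (Fin 2) F := fun i =>
    ⟨c • ((1 : Matrix (Fin 2) (Fin 2) F) + ϖ ^ i • !![0, δ; 0, 0]), c⁻¹ • ((1 : Matrix (Fin 2) (Fin 2) F) - ϖ ^ i • !![0, δ; 0, 0]),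
      by rw [Matrix.smul_mul, Matrix.mul_smul, smul_smul, mul_inv_cancel₀ hc0, one_smul, one_add_smul_nil_mul_one_sub_smul_nil],
      by rw [Matrix.smul_mul, Matrix.mul_smul, smul_smul, inv_mul_cancel₀ hc0, one_smul, one_sub_smul_nil_mul_one_add_smul_nil]⟩
  let gm : GL (Fin 2) F :=
    ⟨c • (1 : Matrix (Fin 2) (Fin 2) F), c⁻¹ • (1 : Matrix (Fin 2) (Fin 2) F),
      by rw [Matrix.smul_mul, Matrix.one_mul, smul_smul, mul_inv_cancel₀ hc0, one_smul],
      by rw [Matrix.smul_mul, Matrix.one_mul, smul_smul, inv_mul_cancel₀ hc0, one_smul]⟩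
  have hgU : ∀ i, g i ∈ unitaryGroupOfForm σ J := fun i => by
    rw [mem_unitaryGroupOfForm_iff, hJ]
    exact conjTranspose_normalForm_mul_swap_mul σ hc (by rw [map_pow, hσϖ]) hσδ
  have hgmU : gm ∈ unitaryGroupOfForm σ J := by
    have h := conjTranspose_normalForm_mul_swap_mul σ hc (by rw [map_pow, hσϖ] : σ (ϖ ^ 0) = ϖ ^ 0) hσδ
    rw [mem_unitaryGroupOfForm_iff, hJ]
    have e : c • (1 : Matrix (Fin 2) (Fin 2) F) = c • ((1 : Matrix (Fin 2) (Fin 2) F) + ϖ ^ 0 • !![0, 0; 0, 0]) := by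
      rw [show (!![0, 0; 0, 0] : Matrix (Fin 2) (Fin 2) F) = 0 from by ext i j; fin_cases i <;> fin_cases j <;> rfl, smul_zero, add_zero]
    have h0 := conjTranspose_normalForm_mul_swap_mul σ hc (by rw [map_pow, hσϖ] : σ (ϖ ^ 0) = ϖ ^ 0) (show σ (0 : F) = -0 by rw [map_zero, neg_zero])
    rw [← e] at h0
    exact h0
  -- integrality of the entries
  have hN : ∀ i (r s : Fin 2), (c • ((1 : Matrix (Fin 2) (Fin 2) F) + ϖ ^ i • !![0, δ; 0, 0])) r s ∈ 𝒪[F] := by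
    intro i r s
    fin_cases r <;> fin_cases s <;>
      simp only [Matrix.smul_apply, Matrix.add_apply, Matrix.one_apply, Matrix.of_apply, Matrix.cons_val', Matrix.cons_val_zero, Matrix.cons_val_one,
        Matrix.cons_val_fin_one, Fin.zero_eta, Fin.mk_one, smul_eq_mul, Fin.isValue, if_true, one_ne_zero, zero_ne_one, if_false, mul_zero, add_zero, zero_add,
        mul_one] <;>
      first | exact hcO | exact zero_mem _ | exact mul_mem hcO (mul_mem (pow_mem hϖO i) hδO)
  have hN' : ∀ i (r s : Fin 2), (c⁻¹ • ((1 : Matrix (Fin 2) (Fin 2) F) - ϖ ^ i • !![0, δ; 0, 0])) r s ∈ 𝒪[F] := by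
    intro i r s
    fin_cases r <;> fin_cases s <;>
      simp only [Matrix.smul_apply, Matrix.sub_apply, Matrix.one_apply, Matrix.of_apply, Matrix.cons_val', Matrix.cons_val_zero, Matrix.cons_val_one,
        Matrix.cons_val_fin_one, Fin.zero_eta, Fin.mk_one, smul_eq_mul, Fin.isValue, if_true, one_ne_zero, zero_ne_one, if_false, mul_zero, sub_zero, zero_sub,
        mul_one, mul_neg] <;>
      first | exact hcO' | exact zero_mem _ | exact neg_mem (mul_mem hcO' (mul_mem (pow_mem hϖO i) hδO))
  refine ⟨⟨gm, hgmU⟩, fun i => ⟨g i, hgU i⟩, ?_, fun i => ?_, rfl, rfl, fun i => rfl, fun i => rfl⟩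
  · refine (mem_glInt_iff gm).2 ⟨fun r s => ?_, fun r s => ?_⟩
    · show (c • (1 : Matrix (Fin 2) (Fin 2) F)) r s ∈ 𝒪[F]
      rw [Matrix.smul_apply, Matrix.one_apply, smul_eq_mul]
      split_ifs
      · rw [mul_one]; exact hcO
      · rw [mul_zero]; exact zero_mem _
    · show (c⁻¹ • (1 : Matrix (Fin 2) (Fin 2) F)) r s ∈ 𝒪[F]
      rw [Matrix.smul_apply, Matrix.one_apply, smul_eq_mul]
      split_ifs
      · rw [mul_one]; exact hcO'
      · rw [mul_zero]; exact zero_mem _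
  · exact (mem_glInt_iff (g i)).2 ⟨hN i, hN' i⟩

end Elements

/-! ## §3 The value law -/

section ValueLaw

variable (σ : F →+* F) {ϖ : F} (hϖ : IsUniformizingElement ϖ) (hσϖ : σ ϖ = ϖ)
  (σO : 𝒪[F] →+* 𝒪[F]) (hσO : ∀ x : 𝒪[F], ((σO x : 𝒪[F]) : F) = σ x) (hσσ : ∀ x, σO (σO x) = x)
  (J : Matrix (Fin 2) (Fin 2) F) (hJ : J = !![0, 1; 1, 0])

include hJ in
/-- **VALUE AT DEPTH `≥ m`**: if `ϖ^{−m}(k − c·1)` is integral then `k = xm · y` with `y ∈ Km`, so `φ k = φ xm` (`xm = c·1`, `|c| = 1`).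
[cite: Rogawski1990, §4.9 Lemma 4.9.3 p. 56] [cite: LabesseLanglands1979, §2] -/
theorem apply_eq_apply_scalar_of_depth_le {c : F} (hc1 : valuation F c = 1) (m : ℕ) (Km : Subgroup ↥(unitaryGroupOfForm σ J))
    (hKm : ∀ y : ↥(unitaryGroupOfForm σ J),
      (∀ r s, ϖ ^ (-(m : ℤ)) * (((y : GL (Fin 2) F) : Matrix (Fin 2) (Fin 2) F) - 1) r s ∈ 𝒪[F]) → y ∈ Km)
    {E : Type*} (φ : ↥(unitaryGroupOfForm σ J) → E) (hφm : ∀ x, ∀ y ∈ Km, φ (x * y) = φ x)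
    (xm : ↥(unitaryGroupOfForm σ J)) (hxm' : (((xm : GL (Fin 2) F)⁻¹ : GL (Fin 2) F) : Matrix (Fin 2) (Fin 2) F) = c⁻¹ • (1 : Matrix (Fin 2) (Fin 2) F))
    (k : ↥(unitaryGroupOfForm σ J))
    (hkm : ∀ r s, ϖ ^ (-(m : ℤ)) * (((k : GL (Fin 2) F) : Matrix (Fin 2) (Fin 2) F) - c • (1 : Matrix (Fin 2) (Fin 2) F)) r s ∈ 𝒪[F]) :
    φ k = φ xm := by
  have _hJ := hJ
  have hc0 : c ≠ 0 := fun h => by rw [h, map_zero] at hc1; exact zero_ne_one hc1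
  have hcO' : c⁻¹ ∈ 𝒪[F] := (Valuation.mem_integer_iff _ _).2 (by rw [map_inv₀, hc1, inv_one])
  -- `y := xm⁻¹ k` has matrix `c⁻¹ k`, so `y − 1 = c⁻¹ (k − c·1)`
  have hy : xm⁻¹ * k ∈ Km := by
    refine hKm _ fun r s => ?_
    have e : (((xm⁻¹ * k : ↥(unitaryGroupOfForm σ J)) : GL (Fin 2) F) : Matrix (Fin 2) (Fin 2) F) - 1 =
        c⁻¹ • (((k : GL (Fin 2) F) : Matrix (Fin 2) (Fin 2) F) - c • (1 : Matrix (Fin 2) (Fin 2) F)) := by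
      rw [Subgroup.coe_mul, Subgroup.coe_inv, Units.val_mul, hxm', Matrix.smul_mul, Matrix.one_mul, smul_sub, smul_smul, inv_mul_cancel₀ hc0, one_smul]
    rw [e, Matrix.smul_apply, smul_eq_mul, mul_left_comm]
    exact mul_mem hcO' (hkm r s)
  calc φ k = φ (xm * (xm⁻¹ * k)) := by rw [mul_inv_cancel_left]
    _ = φ xm := hφm _ _ hy

include hϖ hσϖ hσO hσσ hJ in
/-- **VALUE AT DEPTH EXACTLY `i < m`** (over ★ LEMMA U `localClass_normalForm`): for `k ∈ U(J)` integral with `(k − a)(k − c) = 0` (`a, c` norm-one units,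
`|a − c| = |ϖ^n|`), `i < m ≤ n`, `ϖ^{−i}(k − c·1)` integral but `ϖ^{−(i+1)}(k − c·1)` not: there is `κ ∈ K⁰ = U(J) ∩ GL₂(𝒪)` with `κ⁻¹kκ = x_i · y`, `y ∈ Km`
(`x_i = c(1 + ϖ^i N_δ)`, `κ⁻¹kκ = x_i + ϖ^m R`), hence `φ k = φ (x i)` for `φ` invariant under `Ad K⁰` and right-`Km`. [cite: Rogawski1990, §4.9 Lemma 4.9.3 p. 56]
[cite: LabesseLanglands1979, §2] -/
theorem apply_eq_apply_normalForm_of_depth_eq [IsAdicComplete (IsLocalRing.maximalIdeal 𝒪[F]) 𝒪[F]] [Finite (IsLocalRing.ResidueField 𝒪[F])]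
    {a₀ : 𝒪[F]} (ha₀ : IsUnit (σO a₀ - a₀))
    {a c : F} (ha : σ a * a = 1) (hc : σ c * c = 1) (ha1 : valuation F a = 1) (hc1 : valuation F c = 1)
    {n : ℕ} (hN : valuation F (a - c) = valuation F (ϖ ^ n)) {i m : ℕ} (him : i < m) (hmn : m ≤ n)
    (Km : Subgroup ↥(unitaryGroupOfForm σ J))
    (hKm : ∀ y : ↥(unitaryGroupOfForm σ J),
      (∀ r s, ϖ ^ (-(m : ℤ)) * (((y : GL (Fin 2) F) : Matrix (Fin 2) (Fin 2) F) - 1) r s ∈ 𝒪[F]) → y ∈ Km)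
    {E : Type*} (φ : ↥(unitaryGroupOfForm σ J) → E)
    (hφAd : ∀ κ : ↥(unitaryGroupOfForm σ J), (κ : GL (Fin 2) F) ∈ glInt 2 F → ∀ x, φ (κ * x * κ⁻¹) = φ x)
    (hφm : ∀ x, ∀ y ∈ Km, φ (x * y) = φ x)
    (x : ℕ → ↥(unitaryGroupOfForm σ J))
    (hx' : ∀ j, (((x j : GL (Fin 2) F)⁻¹ : GL (Fin 2) F) : Matrix (Fin 2) (Fin 2) F) =
      c⁻¹ • ((1 : Matrix (Fin 2) (Fin 2) F) - ϖ ^ j • !![0, ((σO a₀ - a₀ : 𝒪[F]) : F); 0, 0]))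
    (k : ↥(unitaryGroupOfForm σ J)) (hkO : ∀ r s, ((k : GL (Fin 2) F) : Matrix (Fin 2) (Fin 2) F) r s ∈ 𝒪[F])
    (hac : (((k : GL (Fin 2) F) : Matrix (Fin 2) (Fin 2) F) - a • 1) * (((k : GL (Fin 2) F) : Matrix (Fin 2) (Fin 2) F) - c • 1) = 0)
    (hki : ∀ r s, ϖ ^ (-(i : ℤ)) * (((k : GL (Fin 2) F) : Matrix (Fin 2) (Fin 2) F) - c • (1 : Matrix (Fin 2) (Fin 2) F)) r s ∈ 𝒪[F])
    (hki' : ¬ ∀ r s, ϖ ^ (-((i : ℤ) + 1)) * (((k : GL (Fin 2) F) : Matrix (Fin 2) (Fin 2) F) - c • (1 : Matrix (Fin 2) (Fin 2) F)) r s ∈ 𝒪[F]) :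
    φ k = φ (x i) := by
  subst hJ
  have hc0 : c ≠ 0 := fun h => by rw [h, map_zero] at hc1; exact zero_ne_one hc1
  have hcO' : c⁻¹ ∈ 𝒪[F] := (Valuation.mem_integer_iff _ _).2 (by rw [map_inv₀, hc1, inv_one])
  have hσOmem : ∀ y ∈ 𝒪[F], σ y ∈ 𝒪[F] := fun y hy => by rw [← hσO ⟨y, hy⟩]; exact (σO ⟨y, hy⟩).2
  have hδO : ((σO a₀ - a₀ : 𝒪[F]) : F) ∈ 𝒪[F] := (σO a₀ - a₀).2
  -- unitarity of `k` in the literal form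
  have hkU : ((((k : GL (Fin 2) F) : Matrix (Fin 2) (Fin 2) F)).map σ)ᵀ * !![0, 1; 1, 0] * ((k : GL (Fin 2) F) : Matrix (Fin 2) (Fin 2) F) = !![0, 1; 1, 0] :=
    mem_unitaryGroupOfForm_iff.1 k.2
  -- LEMMA U
  obtain ⟨κ, hκO, hκU, R, hRO, hid⟩ :=
    localClass_normalForm σ hϖ hσϖ σO hσO hσσ ha₀ hkO hkU ha hc ha1 hc1 hac hN him hmn hki hki'
  -- `κ` as an element of `K⁰ ⊆ U(J)`; its inverse is `J₀ κᴴ J₀`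
  have hinv : !![(0 : F), 1; 1, 0] * (κ.map σ)ᵀ * !![0, 1; 1, 0] * κ = 1 := by
    rw [Matrix.mul_assoc (!![(0 : F), 1; 1, 0] * (κ.map σ)ᵀ), Matrix.mul_assoc !![(0 : F), 1; 1, 0], ← Matrix.mul_assoc ((κ.map σ)ᵀ), hκU,
      swap_mul_swap_eq_one]
  have hinv' : κ * (!![(0 : F), 1; 1, 0] * (κ.map σ)ᵀ * !![0, 1; 1, 0]) = 1 := mul_eq_one_comm.1 hinv
  let κG : GL (Fin 2) F := ⟨κ, !![(0 : F), 1; 1, 0] * (κ.map σ)ᵀ * !![0, 1; 1, 0], hinv', hinv⟩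
  have hκGU : κG ∈ unitaryGroupOfForm σ !![0, 1; 1, 0] := mem_unitaryGroupOfForm_iff.2 hκU
  have hκinvO : ∀ r s, ((!![(0 : F), 1; 1, 0] * (κ.map σ)ᵀ * !![0, 1; 1, 0] : Matrix (Fin 2) (Fin 2) F)) r s ∈ 𝒪[F] := by
    intro r s
    rw [swap_mul_mul_swap_eq]
    fin_cases r <;> fin_cases s <;>
      simp only [Matrix.of_apply, Matrix.cons_val', Matrix.cons_val_zero, Matrix.cons_val_one, Matrix.cons_val_fin_one, Fin.zero_eta, Fin.mk_one,
        Matrix.transpose_apply, Matrix.map_apply] <;> exact hσOmem _ (hκO _ _)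
  have hκGint : κG ∈ glInt 2 F := (mem_glInt_iff κG).2 ⟨hκO, hκinvO⟩
  set κU : ↥(unitaryGroupOfForm σ !![0, 1; 1, 0]) := ⟨κG, hκGU⟩ with hκUdef
  -- `z := κ⁻¹ k κ` and `y := (x i)⁻¹ z`
  have hz : (((κU⁻¹ * k * κU : ↥(unitaryGroupOfForm σ !![0, 1; 1, 0])) : GL (Fin 2) F) : Matrix (Fin 2) (Fin 2) F) =
      c • ((1 : Matrix (Fin 2) (Fin 2) F) + ϖ ^ i • !![0, ((σO a₀ - a₀ : 𝒪[F]) : F); 0, 0]) + ϖ ^ m • R := by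
    rw [Subgroup.coe_mul, Subgroup.coe_mul, Subgroup.coe_inv, Units.val_mul, Units.val_mul, Matrix.coe_units_inv, ← hid]
    show κ⁻¹ * ((k : GL (Fin 2) F) : Matrix (Fin 2) (Fin 2) F) * κ = _
    rw [Matrix.inv_eq_left_inv hinv]
  have hy : (x i)⁻¹ * (κU⁻¹ * k * κU) ∈ Km := by
    refine hKm _ fun r s => ?_
    have e : ((((x i)⁻¹ * (κU⁻¹ * k * κU) : ↥(unitaryGroupOfForm σ !![0, 1; 1, 0])) : GL (Fin 2) F) : Matrix (Fin 2) (Fin 2) F) - 1 =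
        ϖ ^ m • ((c⁻¹ • ((1 : Matrix (Fin 2) (Fin 2) F) - ϖ ^ i • !![0, ((σO a₀ - a₀ : 𝒪[F]) : F); 0, 0])) * R) := by
      rw [Subgroup.coe_mul, Subgroup.coe_inv, Units.val_mul, hz, hx' i, Matrix.mul_add, Matrix.smul_mul, Matrix.mul_smul, Matrix.mul_smul, smul_smul,
        inv_mul_cancel₀ hc0, one_smul, one_sub_smul_nil_mul_one_add_smul_nil, add_sub_cancel_left, Matrix.smul_mul]
    rw [e, Matrix.smul_apply, smul_eq_mul, ← mul_assoc, ← zpow_natCast, ← zpow_add₀ hϖ.ne_zero, neg_add_cancel, zpow_zero, one_mul]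
    refine mul_apply_mem_integer (fun r s => ?_) hRO r s
    fin_cases r <;> fin_cases s <;>
      simp only [Matrix.smul_apply, Matrix.sub_apply, Matrix.one_apply, Matrix.of_apply, Matrix.cons_val', Matrix.cons_val_zero, Matrix.cons_val_one,
        Matrix.cons_val_fin_one, Fin.zero_eta, Fin.mk_one, smul_eq_mul, Fin.isValue, if_true, one_ne_zero, zero_ne_one, if_false, mul_zero, sub_zero, zero_sub,
        mul_one, mul_neg] <;>
      first | exact hcO' | exact zero_mem _ | exact neg_mem (mul_mem hcO' (mul_mem (pow_mem hϖ.mem i) hδO))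
  -- assemble: `k = κ · (x_i · y) · κ⁻¹`
  have hk : k = κU * (x i * ((x i)⁻¹ * (κU⁻¹ * k * κU))) * κU⁻¹ := by group
  rw [hk, hφAd κU hκGint, hφm _ _ hy]

end ValueLaw

/-! ## §4 The eigen-relation of a conjugate and the antitonicity of the depth predicate -/

section Eigen

omit [ValuativeRel F] in
/-- **`(k − u₀·1)(k − u₁·1) = 0` for `k = g⁻¹ γ g` when `γ P = P · diag(u)`** (the conjugate of a diagonalisable element with eigenvalues `u₀, u₁`).
[cite: Rogawski1990, §4.9 p. 54] -/
theorem sub_smul_mul_sub_smul_eq_zero_of_conj_diagonal (γ P g : GL (Fin 2) F) {u : Fin 2 → F}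
    (hP : (γ : Matrix (Fin 2) (Fin 2) F) * P = P * diagonal u) :
    ((((g⁻¹ * γ * g : GL (Fin 2) F)) : Matrix (Fin 2) (Fin 2) F) - u 0 • (1 : Matrix (Fin 2) (Fin 2) F)) *
        (((g⁻¹ * γ * g : GL (Fin 2) F) : Matrix (Fin 2) (Fin 2) F) - u 1 • (1 : Matrix (Fin 2) (Fin 2) F)) = 0 := by
  -- `k = R⁻¹ D R` with `R := P⁻¹ g`, `D = diag(u)`
  set R : GL (Fin 2) F := P⁻¹ * g with hR
  have hγ : (γ : Matrix (Fin 2) (Fin 2) F) = (P : Matrix (Fin 2) (Fin 2) F) * diagonal u * ((P⁻¹ : GL (Fin 2) F) : Matrix (Fin 2) (Fin 2) F) := by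
    rw [← hP, Matrix.mul_assoc, ← Units.val_mul, mul_inv_cancel, Units.val_one, Matrix.mul_one]
  have hk : (((g⁻¹ * γ * g : GL (Fin 2) F)) : Matrix (Fin 2) (Fin 2) F) =
      ((R⁻¹ : GL (Fin 2) F) : Matrix (Fin 2) (Fin 2) F) * diagonal u * (R : Matrix (Fin 2) (Fin 2) F) := by
    rw [Units.val_mul, Units.val_mul, hγ, hR, _root_.mul_inv_rev, inv_inv, Units.val_mul, Units.val_mul]
    simp only [Matrix.mul_assoc]
  have hsub : ∀ t : F, ((R⁻¹ : GL (Fin 2) F) : Matrix (Fin 2) (Fin 2) F) * diagonal u * (R : Matrix (Fin 2) (Fin 2) F) - t • 1 =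
      ((R⁻¹ : GL (Fin 2) F) : Matrix (Fin 2) (Fin 2) F) * (diagonal u - t • 1) * (R : Matrix (Fin 2) (Fin 2) F) := by
    intro t
    rw [Matrix.mul_sub, Matrix.sub_mul, Matrix.mul_smul, Matrix.mul_one, Matrix.smul_mul, ← Units.val_mul, inv_mul_cancel, Units.val_one]
  have hdiag : (diagonal u - u 0 • (1 : Matrix (Fin 2) (Fin 2) F)) * (diagonal u - u 1 • 1) = 0 := by
    ext i j
    fin_cases i <;> fin_cases j <;> simp [Matrix.mul_apply, Fin.sum_univ_two, Matrix.diagonal, Matrix.one_apply]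
  rw [hk, hsub, hsub, show ((R⁻¹ : GL (Fin 2) F) : Matrix (Fin 2) (Fin 2) F) * (diagonal u - u 0 • 1) * (R : Matrix (Fin 2) (Fin 2) F) *
      (((R⁻¹ : GL (Fin 2) F) : Matrix (Fin 2) (Fin 2) F) * (diagonal u - u 1 • 1) * (R : Matrix (Fin 2) (Fin 2) F)) =
      ((R⁻¹ : GL (Fin 2) F) : Matrix (Fin 2) (Fin 2) F) * ((diagonal u - u 0 • 1) * ((R : Matrix (Fin 2) (Fin 2) F) *
        ((R⁻¹ : GL (Fin 2) F) : Matrix (Fin 2) (Fin 2) F)) * (diagonal u - u 1 • 1)) * (R : Matrix (Fin 2) (Fin 2) F) by simp only [Matrix.mul_assoc],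
    ← Units.val_mul, mul_inv_cancel, Units.val_one, Matrix.mul_one, hdiag, Matrix.mul_zero, Matrix.zero_mul]

/-- **The depth predicate is antitone in the level**: `ϖ^{−j} M` integral and `i ≤ j` ⇒ `ϖ^{−i} M` integral (`ϖ ∈ 𝒪`). [cite: Rogawski1990, §4.9 p. 54] -/
theorem depthPred_anti {ϖ : F} (hϖ : IsUniformizingElement ϖ) (M : Matrix (Fin 2) (Fin 2) F) {i j : ℕ} (hij : i ≤ j)
    (h : ∀ r s, ϖ ^ (-(j : ℤ)) * M r s ∈ 𝒪[F]) (r s : Fin 2) : ϖ ^ (-(i : ℤ)) * M r s ∈ 𝒪[F] := by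
  have e : ϖ ^ (-(i : ℤ)) * M r s = ϖ ^ (j - i) * (ϖ ^ (-(j : ℤ)) * M r s) := by
    rw [← mul_assoc, ← zpow_natCast, ← zpow_add₀ hϖ.ne_zero, Nat.cast_sub hij]; congr 2; ring
  rw [e]
  exact mul_mem (pow_mem hϖ.mem _) (h r s)

/-- **Depth `0` is automatic** for an integral `k` and an integral scalar `c`. [cite: Rogawski1990, §4.9 p. 54] -/
theorem depthPred_zero {k : Matrix (Fin 2) (Fin 2) F} (hkO : ∀ r s, k r s ∈ 𝒪[F]) {c : F} (hcO : c ∈ 𝒪[F]) (r s : Fin 2) :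
    (1 : F) * (k - c • (1 : Matrix (Fin 2) (Fin 2) F)) r s ∈ 𝒪[F] := by
  rw [one_mul, Matrix.sub_apply, Matrix.smul_apply, Matrix.one_apply, smul_eq_mul]
  split_ifs
  · rw [mul_one]; exact sub_mem (hkO r s) hcO
  · rw [mul_zero, sub_zero]; exact hkO r s

end Eigen

end Literature.NumberTheory.Automorphic

end
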